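import Mathlib
import Summits.MatrixMultiplication.MatrixMultiplication.Theorems.SnSubsetDichotomyPolynomialSlackPolylogPower

/-!
# `SnSubsetDichotomy.PolynomialSlack`, line `transport-split-hull` — stub `eventually_gain_sharp`

Crux `Summit.MatrixMultiplication.MatrixMultiplication.Theses.SnSubsetDichotomy.PolynomialSlack`
(item `stmt-MatrixMultiplication-8306`), level-one programme ("5/8 step"), lead c8.  Registered
stub `eventually_gain_sharp` (E2) of `Cruxes/PolynomialSlack/Lines/transport-split-hull.lean`;
pure real asymptotics.

The sharp structure theorem bounds the volume of a pure violator in `S_n` by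
`3·10^24·(1 + log n)^12·n·B`, where `B` is the maximal TPP volume in `S_{n-1}`; after
purification (a factor `8`) the induction on `n` needs this prefactor to be at most
`n ^ (3/2 - κ)` with `κ = 1/4` for all large `n`.  This is the instance `k = 12`, `p = 1`,
`q = 5/4`, `c = 8 · (3 · 10^24)` of the master comparison `eventually_log_pow_mul_rpow_le`
(a polylog times a power is eventually below any larger power), after `n ^ (1 : ℝ) = n`
(`Real.rpow_one`) and `3/2 - 1/4 = 5/4`.
-/

namespace Summit.MatrixMultiplication.MatrixMultiplication.Theorems.PolynomialSlack

-- `Summit.<Summit>.<Problem>` is the tree's mandated summit-side namespace; for this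
-- single-conjunct summit the two coincide, so the file silences `dupNamespace`.
set_option linter.dupNamespace false

/-- **Eventual gain of the sharp structure bound** (registered stub `eventually_gain_sharp` of
line `transport-split-hull`): for all large naturals `n`,
`8 · (3·10^24 · (1 + log n)^12 · n) ≤ n ^ (3/2 - 1/4)`
(`eventually_log_pow_mul_rpow_le` with `k = 12`, `p = 1 < q = 5/4`, `c = 8 · (3 · 10^24)`,
then `Real.rpow_one` and `3/2 - 1/4 = 5/4`). [folklore] -/
theorem eventually_gain_sharp :
    ∃ n₀ : ℕ, ∀ n : ℕ, n₀ ≤ n →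
      8 * (3 * 10 ^ 24 * (1 + Real.log n) ^ 12 * n) ≤ (n : ℝ) ^ ((3 : ℝ) / 2 - 1 / 4) := by
  obtain ⟨n₀, h⟩ :=
    eventually_log_pow_mul_rpow_le 12 1 (5 / 4) (8 * (3 * 10 ^ 24)) (by norm_num) (by norm_num)
  refine ⟨n₀, fun n hn => ?_⟩
  have hn' := h n hn
  rw [Real.rpow_one] at hn'
  rw [show (3 : ℝ) / 2 - 1 / 4 = 5 / 4 by norm_num]
  calc 8 * (3 * 10 ^ 24 * (1 + Real.log n) ^ 12 * n)
      = 8 * (3 * 10 ^ 24) * (1 + Real.log n) ^ 12 * (n : ℝ) := by ring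
    _ ≤ (n : ℝ) ^ ((5 : ℝ) / 4) := hn'

end Summit.MatrixMultiplication.MatrixMultiplication.Theorems.PolynomialSlack
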